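import Summits.QuantumFields.YangMills.Theorems.BalabanUVNodesK0Stub1Letters10OnA1
import Summits.QuantumFields.YangMills.Theorems.BalabanUVNodesK0Stub1H128OfFlatSocket
import Summits.QuantumFields.YangMills.Theorems.BalabanUVNodesK0Stub1FlatCurrentA1LineRowsAtRecord
import HarnessLib

/-!
# K0⁷ STUB 1 (V20-G stub 1-G `stub_prop8StepCoPG13`), sub-target S4a — **THE A₁ LINE OF (165) FROM THE ♭ (127) SOCKET, END TO END AT THE RECORD's FAMILIES**:
# p612312's `Letters10On Y η_{K−n} t (⇑X − H_V(Q_V⇑X))` with its (128) hypothesis `h128` and its three S4b rows `hWq`∕`hWA`∕`hWtr` DISCHARGED on the ♭ road — ONE `obtain`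
# of k0-s1-w4's `exists_sectF_W_flatScaled_atRecord_socket_A1rows` (k0-s1-w2's socket p642782 ∧ the rows) + p643165 `h128_of_socket127_flat`

Cell `pub-ymgap`, width seat `pub-ymgap-k0-s1-w1` g8 (CLAIM-5; HANDOFF § g8 (t1)).  `--kind proof --supports stmt-QuantumFields-20541 --as helper`; count-neutral.
[15] = [Balaban1985Variational]; [B6] = [Balaban1984PropagatorsII]; [III] = [Balaban1988Convergent].

WHY.  The A₁ LINE of the S6 head (g4 ✓`K0Stub1Letters10OnA1.exists_letters10On_A1_closed_of_adm22_T4`) delivers n07-w4's `Letters10On Y η_{K−n} t A₁`, `A₁ = ⇑X − H_V(Q_V ⇑X)`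
([15] (159)∕(165)), from four rows of a current `W` at `X` — `hWq` ((98) size), `hWA`∕`hWtr` (skew, traceless), `h128` (criticality (128) on `ker Q_V`) — plus the slice (153) and
the sizes of `X`.  On the ♭ road all four rows are now theorems: k0-s1-w2's ✓p642782 `exists_sectF_W_flatScaled_atRecord_socket` lands the (127) socket at the record for
Sect. F's current `W_S` (D‴), k0-s1-w4's ✓`exists_sectF_W_flatScaled_atRecord_socket_A1rows` re-exports it with `hWq`∕`hWA`∕`hWtr` for THIS seat's named current
`W_A₁ Y := (i·c²·η^d·η⁻¹)•(W_S((iη)⁻¹•Y))♮` (`c = L^{K−n}`, `η = L^{−(K−n)}`, `♮` = traceless part), and g8 ✓p643165 `h128_of_socket127_flat` ∘ `re_trace_pairing_rescaled_current_traceless`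
turns the socket into `h128` for `W_A₁ ⇑X`.  THIS FILE composes them: for every admissible family of the record's four-tori, Sect. F's ♭ chart `(H♭, Dsel)` is RE-EXPORTED with its
defining rows (kernel formula, (55)♭, `C^ω`, (48)♭∧(49)♭, herm0 — so the final assembler can identify the charted minimiser), and for every `𝔰𝔲(N)`-valued `X` of (152) rows
`≤ ρ′ < η·ε` on the slice (153) whose charted point `e^{iη(A′₁ − H♭·Dsel A′₁)}`, `A′₁ = (iη)⁻¹•⇑X`, read by an `SU(N)` configuration `U₁` CRITICAL ON THE RECORD's FIBRE
(`Node00.IsCritOnFibre F N K 𝔹 …`, `𝔹` on (2.3) index bonds of level `≤ K − n`): `Letters10On Y η_{K−n} t (⇑X − H_V(Q_V ⇑X))` for `t` above the displayed threshold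
(`max B₀ (1 + (B₀B₃+1)·L·C_G) · (2·(c²η^dη⁻¹)·η⁻²·C₄) · ρ′²`).

WHAT IS PROVED (sorry-free; no definition; axioms standard; `F : T4Family`, `N ≥ 1`).
* `hermLetter_rows_lt` — rows `≤ ρ′ < η·ε` of `⇑X` put `(iη)⁻¹•⇑X` strictly inside the two-size `ε`-window (k0-s1-w4 ✓`norm_inv_I_eta_smul`).
* ★★★★ `exists_letters10On_A1_of_flatSocket_T4` — the composition above; displayed ONLY: the family, p595460's kernel-formula letters `DV GV MV QV HV`, the sizes and the slice of
  `X`, `𝔹`, `U₁` reading the charted point, `IsCritOnFibre … U₁`, `Y ⊆ Ω_{K−n}`, the threshold.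
HONEST SCOPE.  `obtain` + `exact` over landed files cited BY NAME; the criticality of the charted configuration on the record's fibre (input (i): the minimiser's criticality + its
Landau∕axial gauge copy read in the ♭ chart — K0 road §1 ∕ (92)∕(97)∕(99) identification, NOT this seat), the slice (153) and the sizes (S3) remain HYPOTHESES; under reading (b) of
`B15.bondsOf` the `𝔹`-hypothesis excludes one-ended bonds (ME #35, displayed honestly); NO estimate of Bałaban's proved or asserted; stub 1-G `stub_prop8StepCoPG13` ∕ K0⁷ NOT
closed (ONE PEN: not this seat); N07 NOT discharged; counts unmoved (28∕28 · 5∕27); one finite 𝕋⁴ programme at fixed ε — R4 closes the conditional finite-𝕋⁴ rung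
`BalabanLadder.UV` only, never the summit; the YM mass gap (Clay) is NOT proved by any of this; nothing continuum ∕ ℝ⁴ ∕ OS.  No `sorry`, no `def`, no `instance`, no `notation`.

References: [15] T. Bałaban, CMP **102** (1985) 277–309 ((5)–(6) p.278, (22) p.281, (27) p.282, (44)–(49) p.285, (97)–(98) pp.292–293, (127)–(128) p.297, (152)–(153) p.301,
(156)–(159) p.302, (165) p.303); [B6] CMP **96** (1984) 223–250 ((2.3) p.224, (2.19) p.226); [III] CMP **119** (1988) 243–285 ((2.10)–(2.12) p.256).
-/

set_option autoImplicit false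

noncomputable section

open scoped BigOperators Matrix Matrix.Norms.L2Operator InnerProductSpace RealInnerProductSpace ContDiff

namespace Summit.QuantumFields.YangMills.Theorems.K0Stub1Letters10OnA1OfFlatSocket

open Literature.MathematicalPhysics.QuantumFieldTheory.Balaban1983to89
open Literature.MathematicalPhysics.QuantumFieldTheory.Balaban1983to89.Node00
open T4Continuum (T4Family)
open T4AdjointCovarianceUnitary (lieSU mem_lieSU_iff)
open B9AdOrthogonal (herm0)
open B15DeterminingSets (bondsOf DetSet avgFamily)
open B6SectADomainsV1 (Domains)
open B6SectAOperatorsV1 (BondIdx QE QsE RE dsE)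
open B6SectAVectorModelV1 (deltaAE GE EE)
open B6SectA (hOp)
open Summit.QuantumFields.YangMills.Theorems.FlatCubeOpsText (Adm22)
open Summit.QuantumFields.YangMills.Theorems.K0FlatCubeOpsTextP (IsLevWeight flatH levWeight_nonneg)
open Summit.QuantumFields.YangMills.Theorems.Prop8Chart (expCfg)
open Summit.QuantumFields.YangMills.Theorems.Prop8ChartDoubleBar (chartLogFlat)
open Summit.QuantumFields.YangMills.BalabanUVNodes.N07HalvingStepTopOfLocalLetters (Letters10On)
open Summit.QuantumFields.YangMills.Theorems.K0Stub1Letters10OnA1 (exists_letters10On_A1_closed_of_adm22_T4)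
open Summit.QuantumFields.YangMills.Theorems.K0Stub1H128OfFlatSocket (h128_of_socket127_flat re_trace_pairing_rescaled_current_traceless inv_I_eta_smul_mem_herm0)
open Summit.QuantumFields.YangMills.Theorems.K0Stub1FlatCurrentA1LineRows (norm_inv_I_eta_smul)
open Summit.QuantumFields.YangMills.Theorems.K0Stub1FlatCurrentA1LineRowsAtRecord (exists_sectF_W_flatScaled_atRecord_socket_A1rows)

variable {N : ℕ} [NeZero N]

omit [NeZero N] in
/-- the Hermitian letter `(iη)⁻¹•⇑X` of an `𝔰𝔲(N)`-valued field of rows `≤ ρ′ < η·ε` lies in the two-size `ε`-window (strictly). [cite: Balaban1985Variational, (22) p.281, (152) p.301] -/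
theorem hermLetter_rows_lt {P : Params} {η ε ρ' Λ : ℝ} (hη : 0 < η) (w : ℕ → PBond P 0 → ℝ) (X : PBond P 0 → lieSU (Fin N)) (hρ' : ρ' < η * ε)
    (h1 : ∀ b, w 1 b * ‖((X b : lieSU (Fin N)) : Matrix (Fin N) (Fin N) ℂ)‖ ≤ ρ')
    (h2 : ∀ (b : PBond P 0) (ν : Fin P.d),
      w 2 b * Λ * ‖((X ⟨b.src.shift ν, b.dir⟩ : lieSU (Fin N)) : Matrix (Fin N) (Fin N) ℂ) - ((X b : lieSU (Fin N)) : Matrix (Fin N) (Fin N) ℂ)‖ ≤ ρ') :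
    (∀ b, w 1 b * ‖(Complex.I * (η : ℂ))⁻¹ • ((X b : lieSU (Fin N)) : Matrix (Fin N) (Fin N) ℂ)‖ < ε) ∧
    ∀ (b : PBond P 0) (ν : Fin P.d), w 2 b * Λ *
      ‖(fun b => (Complex.I * (η : ℂ))⁻¹ • ((X b : lieSU (Fin N)) : Matrix (Fin N) (Fin N) ℂ)) ⟨b.src.shift ν, b.dir⟩ -
        (fun b => (Complex.I * (η : ℂ))⁻¹ • ((X b : lieSU (Fin N)) : Matrix (Fin N) (Fin N) ℂ)) b‖ < ε := by
  have hηε : η⁻¹ * ρ' < ε := by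
    rw [inv_mul_lt_iff₀ hη]; exact hρ'
  constructor
  · intro b
    rw [norm_inv_I_eta_smul hη, mul_left_comm]
    exact lt_of_le_of_lt (mul_le_mul_of_nonneg_left (h1 b) (inv_nonneg.2 hη.le)) hηε
  · intro b ν
    rw [← smul_sub, norm_inv_I_eta_smul hη, mul_left_comm (w 2 b * Λ)]
    exact lt_of_le_of_lt (mul_le_mul_of_nonneg_left (h2 b ν) (inv_nonneg.2 hη.le)) hηε

/-- ★★★★ **THE A₁ LINE OF (165) FROM THE ♭ (127) SOCKET — END TO END AT THE RECORD's FAMILIES.**  For every `F : T4Family` and `N ≥ 1` there are k-uniform constants such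
that for every admissible family of the record's four-tori (`D.k = K − n`, `Adm22 D R (L·M_h)`, (152) weights) and p595460's kernel-formula letters `DV GV MV QV HV`, Sect. F's ♭
chart `(H♭, Dsel)` (re-exported with its defining rows: kernel formula, (55)♭, `C^ω`, (48)♭∧(49)♭, herm0) satisfies: for every `𝔰𝔲(N)`-valued `X` of (152) rows `≤ ρ′ < η·ε`
(`η = L^{−(K−n)}`) ON THE SLICE (153), every determining set `𝔹` of (2.3) index bonds of level `≤ K − n`, and every `SU(N)` configuration `U₁` READING THE CHARTED POINT
`e^{iη(A′₁ − H♭·Dsel A′₁)}`, `A′₁ := (iη)⁻¹•⇑X`, that is CRITICAL ON THE RECORD's FIBRE (`Node00.IsCritOnFibre`): **`Letters10On Y η_{K−n} t (⇑X − H_V(Q_V ⇑X))`** on every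
`Y ⊆ Ω_{K−n}` for every `t` above the displayed threshold.  ONE `obtain` of k0-s1-w4's ✓`exists_sectF_W_flatScaled_atRecord_socket_A1rows` (= k0-s1-w2's p642782 socket ∧ the
three `W`-rows) + p643165 `h128_of_socket127_flat` (the fourth row) fed into p612312 ✓`exists_letters10On_A1_closed_of_adm22_T4`; the (128)∕S2 and `hWq`∕S4b displayed
hypotheses of the A₁ line are DISCHARGED on the ♭ road — displayed remain the criticality of the charted configuration, the slice (153) and the sizes of `X` (S3).
[cite: Balaban1985Variational, (5)-(6) p.278, (22) p.281, (27) p.282, (44)-(49) p.285, (127)-(128) p.297, (152)-(153) p.301, (156)-(159) p.302, (165) p.303; Balaban1984PropagatorsII, (2.3) p.224, (2.19) p.226; Balaban1988Convergent, (2.10)-(2.12) p.256] -/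
theorem exists_letters10On_A1_of_flatSocket_T4 (F : T4Family) :
    ∃ (Mh₀ R₀ : ℕ) (B₀ δ₀ B₃ CG ε C₄ : ℝ), 0 < δ₀ ∧ 0 < B₃ ∧ 0 ≤ CG ∧ 0 < ε ∧ 0 ≤ C₄ ∧
    ∀ (n K : ℕ) (_ : 1 ≤ K - n) (_ : K - n + 1 ≤ F.m + K) {Mh R a' : ℕ} (_ : Mh = F.L ^ a') (_ : Mh₀ ≤ Mh) (_ : R₀ ≤ R)
      (_ : a' + 3 ≤ F.m + n) (D : Domains (F.P K)) (_ : D.k = K - n) (_ : Adm22 D R (F.L * Mh))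
      (w : ℕ → PBond (F.P K) 0 → ℝ) (_ : IsLevWeight (F.P K) (K - n) D w),
    -- Sect. F's ♭ chart at this family, RE-EXPORTED with its defining rows
    ∃ (H : (BondIdx D → Matrix (Fin N) (Fin N) ℂ) →ₗ[ℂ] (PBond (F.P K) 0 → Matrix (Fin N) (Fin N) ℂ))
      (Dsel : (PBond (F.P K) 0 → Matrix (Fin N) (Fin N) ℂ) → (BondIdx D → Matrix (Fin N) (Fin N) ℂ)),
      (∀ (X : BondIdx D → Matrix (Fin N) (Fin N) ℂ) (b : PBond (F.P K) 0), H X b =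
        ∑ t, (((((F.P K).L : ℝ) ^ (t.1.1 : ℕ) * ((((F.P K).L : ℝ))⁻¹) ^ (K - n))⁻¹ * flatH (F.P K) (K - n) D (Pi.single t 1) b : ℝ) : ℂ) • X t) ∧
      (∀ A' : PBond (F.P K) 0 → Matrix (Fin N) (Fin N) ℂ, (∀ b, w 1 b * ‖A' b‖ < ε) →
        ∀ ρ' : ℝ, 0 ≤ ρ' → (∀ b, w 1 b * ‖A' b‖ ≤ ρ') → ∀ i : BondIdx D, ‖Dsel A' i‖ ≤ C₄ * ρ' ^ 2) ∧
      ContDiffOn ℂ ω Dsel {Y : PBond (F.P K) 0 → Matrix (Fin N) (Fin N) ℂ | ∀ b, w 1 b * ‖Y b‖ < ε} ∧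
      (∀ A' : PBond (F.P K) 0 → Matrix (Fin N) (Fin N) ℂ, (∀ b, w 1 b * ‖A' b‖ < ε) →
        chartLogFlat (((((F.P K).L : ℝ))⁻¹) ^ (K - n)) D (A' - H (Dsel A')) - (fderiv ℂ (chartLogFlat (((((F.P K).L : ℝ))⁻¹) ^ (K - n)) D :
        (PBond (F.P K) 0 → Matrix (Fin N) (Fin N) ℂ) → BondIdx D → Matrix (Fin N) (Fin N) ℂ) 0) (A' - H (Dsel A')) = Dsel A' ∧
        chartLogFlat (((((F.P K).L : ℝ))⁻¹) ^ (K - n)) D (A' - H (Dsel A')) = (fderiv ℂ (chartLogFlat (((((F.P K).L : ℝ))⁻¹) ^ (K - n)) D :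
        (PBond (F.P K) 0 → Matrix (Fin N) (Fin N) ℂ) → BondIdx D → Matrix (Fin N) (Fin N) ℂ) 0) A') ∧
      (∀ A' : PBond (F.P K) 0 → Matrix (Fin N) (Fin N) ℂ, (∀ b, w 1 b * ‖A' b‖ < ε) → (∀ b, A' b ∈ herm0 (Fin N)) →
        (∀ i, Dsel A' i ∈ herm0 (Fin N)) ∧ ∀ b, (A' - H (Dsel A')) b ∈ herm0 (Fin N)) ∧
      -- THE A₁ LINE: p595460's kernel-formula letters; then every small 𝔰𝔲(N)-valued `X` on the slice whose charted point is critical on the record's fibre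
      ∀ {instDE : DecidableEq (PBond (F.P K) 0)} {instDB : DecidableEq (BondIdx D)}
    {DV GV MV : (PBond (F.P K) 0 → Matrix (Fin N) (Fin N) ℂ) →ₗ[ℂ] (PBond (F.P K) 0 → Matrix (Fin N) (Fin N) ℂ)}
    {QV : (PBond (F.P K) 0 → Matrix (Fin N) (Fin N) ℂ) →ₗ[ℂ] (BondIdx D → Matrix (Fin N) (Fin N) ℂ)}
    {HV : (BondIdx D → Matrix (Fin N) (Fin N) ℂ) →ₗ[ℂ] (PBond (F.P K) 0 → Matrix (Fin N) (Fin N) ℂ)}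
    (_ : ∀ (A : PBond (F.P K) 0 → Matrix (Fin N) (Fin N) ℂ) (b : PBond (F.P K) 0),
      DV A b = ∑ j, ((WithLp.ofLp (deltaAE D ((F.P K).L ^ (K - n) : ℝ) (fun _ => (1 : ℝ)) (WithLp.toLp 2 (Pi.single j 1))) b : ℝ) : ℂ) • A j)
    (_ : ∀ (A : PBond (F.P K) 0 → Matrix (Fin N) (Fin N) ℂ) (b : PBond (F.P K) 0),
      GV A b = ∑ j, ((WithLp.ofLp ((GE D (c := ((F.P K).L : ℝ) ^ (K - n)) (pow_ne_zero _ (Nat.cast_ne_zero.2 (F.P K).L_pos.ne')) (w := fun _ => (1 : ℝ)) (fun _ => one_pos)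
        - hOp (GE D (c := ((F.P K).L : ℝ) ^ (K - n)) (pow_ne_zero _ (Nat.cast_ne_zero.2 (F.P K).L_pos.ne')) (w := fun _ => (1 : ℝ)) (fun _ => one_pos)) (QsE D)
            (EE D (c := ((F.P K).L : ℝ) ^ (K - n)) (pow_ne_zero _ (Nat.cast_ne_zero.2 (F.P K).L_pos.ne')) (w := fun _ => (1 : ℝ)) (fun _ => one_pos))
          ∘ₗ QE D ∘ₗ GE D (c := ((F.P K).L : ℝ) ^ (K - n)) (pow_ne_zero _ (Nat.cast_ne_zero.2 (F.P K).L_pos.ne')) (w := fun _ => (1 : ℝ)) (fun _ => one_pos))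
        (WithLp.toLp 2 (Pi.single j 1))) b : ℝ) : ℂ) • A j)
    (_ : ∀ (A : PBond (F.P K) 0 → Matrix (Fin N) (Fin N) ℂ) (t : BondIdx D),
      QV A t = ∑ j, ((WithLp.ofLp (QE D (WithLp.toLp 2 (Pi.single j 1))) t : ℝ) : ℂ) • A j)
    (_ : ∀ (B : BondIdx D → Matrix (Fin N) (Fin N) ℂ) (b : PBond (F.P K) 0),
      HV B b = ∑ t, ((WithLp.ofLp (hOp (GE D (c := ((F.P K).L : ℝ) ^ (K - n)) (pow_ne_zero _ (Nat.cast_ne_zero.2 (F.P K).L_pos.ne')) (w := fun _ => (1 : ℝ)) (fun _ => one_pos))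
        (QsE D) (EE D (c := ((F.P K).L : ℝ) ^ (K - n)) (pow_ne_zero _ (Nat.cast_ne_zero.2 (F.P K).L_pos.ne')) (w := fun _ => (1 : ℝ)) (fun _ => one_pos))
        (WithLp.toLp 2 (Pi.single t 1))) b : ℝ) : ℂ) • B t)
    (_ : ∀ (A : PBond (F.P K) 0 → Matrix (Fin N) (Fin N) ℂ) (b : PBond (F.P K) 0),
      MV A b = ∑ j, ((WithLp.ofLp ((QsE D
          ∘ₗ EE D (c := ((F.P K).L : ℝ) ^ (K - n)) (pow_ne_zero _ (Nat.cast_ne_zero.2 (F.P K).L_pos.ne')) (w := fun _ => (1 : ℝ)) (fun _ => one_pos)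
          ∘ₗ QE D ∘ₗ GE D (c := ((F.P K).L : ℝ) ^ (K - n)) (pow_ne_zero _ (Nat.cast_ne_zero.2 (F.P K).L_pos.ne')) (w := fun _ => (1 : ℝ)) (fun _ => one_pos))
        (WithLp.toLp 2 (Pi.single j 1))) b : ℝ) : ℂ) • A j)
        (X : PBond (F.P K) 0 → lieSU (Fin N)) (ρ' : ℝ) (_ : ρ' < ((((F.P K).L : ℝ)⁻¹) ^ (K - n)) * ε)
        (_ : ∀ b, w 1 b * ‖((X b : lieSU (Fin N)) : Matrix (Fin N) (Fin N) ℂ)‖ ≤ ρ')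
        (_ : ∀ (b : PBond (F.P K) 0) (ν : Fin 4),
          w 2 b * (F.L : ℝ) ^ (K - n) * ‖((X ⟨b.src.shift ν, b.dir⟩ : lieSU (Fin N)) : Matrix (Fin N) (Fin N) ℂ) - ((X b : lieSU (Fin N)) : Matrix (Fin N) (Fin N) ℂ)‖ ≤ ρ')
        (_ : ∀ φ : Matrix (Fin N) (Fin N) ℂ →L[ℂ] ℂ,
          RE D (((F.P K).L : ℝ) ^ (K - n)) (dsE (((F.P K).L : ℝ) ^ (K - n)) (WithLp.toLp 2 (fun b => (φ ((X b : lieSU (Fin N)) : Matrix (Fin N) (Fin N) ℂ)).re))) = 0)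
        (𝔹 : DetSet (F.P K)) (_ : ∀ (j : ℕ) (b : PBond (F.P K) j), b ∈ bondsOf (𝔹 j) → j ≤ K - n ∧ D.LamBond j b)
        (U₁ : GaugeField (F.P K) 0 (SU N))
        (_ : ∀ b, ((U₁ b : SU N) : Matrix (Fin N) (Fin N) ℂ) =
          ((expCfg ((((F.P K).L : ℝ)⁻¹) ^ (K - n))
            ((fun b => (Complex.I * (((((F.P K).L : ℝ)⁻¹) ^ (K - n) : ℝ) : ℂ))⁻¹ • ((X b : lieSU (Fin N)) : Matrix (Fin N) (Fin N) ℂ)) -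
              H (Dsel (fun b => (Complex.I * (((((F.P K).L : ℝ)⁻¹) ^ (K - n) : ℝ) : ℂ))⁻¹ • ((X b : lieSU (Fin N)) : Matrix (Fin N) (Fin N) ℂ)))) b :
            (Matrix (Fin N) (Fin N) ℂ)ˣ) : _))
        (_ : IsCritOnFibre F N K 𝔹 (avgFamily (avOfRecord F N K) U₁) U₁)
        {Y : Set (Site (F.P K) 0)} (_ : ∀ x ∈ Y, D.InOm (K - n) x) {t : ℝ}
        (_ : max B₀ (1 + (B₀ * B₃ + 1) * (F.L : ℝ) * CG) *
          ((2 * (((F.P K).L ^ (K - n) : ℝ) ^ 2 * ((((F.P K).L : ℝ)⁻¹) ^ (K - n)) ^ (F.P K).d * ((((F.P K).L : ℝ)⁻¹) ^ (K - n))⁻¹) *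
            ((((F.P K).L : ℝ)⁻¹) ^ (K - n))⁻¹ ^ 2 * C₄) * ρ' ^ 2) < t),
        Letters10On Y ((F.P K).eta (K - n)) t
          ((fun b => ((X b : lieSU (Fin N)) : Matrix (Fin N) (Fin N) ℂ)) - HV (QV fun b => ((X b : lieSU (Fin N)) : Matrix (Fin N) (Fin N) ℂ))) := by
  obtain ⟨Mh₀, R₀, B₀, δ₀, B₃, CG, hδ₀, hB₃, hCG, hA1⟩ := exists_letters10On_A1_closed_of_adm22_T4 (N := N) F
  obtain ⟨Mh₀', R₀', ε, C₄, hε, hC₄, hS⟩ := exists_sectF_W_flatScaled_atRecord_socket_A1rows N F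
  refine ⟨max Mh₀ Mh₀', max R₀ R₀', B₀, δ₀, B₃, CG, ε, C₄, hδ₀, hB₃, hCG, hε, hC₄, ?_⟩
  intro n K h1K hKm Mh R a' hMha hMh₀ hR₀ ha' D hDk hAdm w hw
  obtain ⟨τ, ρ, BE, B, hc, hwa, MVf, H, Dsel, Qt, Ht, Dt, e, WS, hntr, hρ, hBE, hB, hMVf, hH, h55, hcd, hfix, hherm, hQt, hHt, hDt, he, h157, hdiff, h158,
    hsock, hWq, hWAtr⟩ := hS n K h1K hKm hMha (le_trans (le_max_right _ _) hMh₀) (le_trans (le_max_right _ _) hR₀) ha' D hDk hAdm hw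
  refine ⟨H, Dsel, hH, h55, hcd, hfix, hherm, ?_⟩
  intro instDE instDB DV GV MV QV HV hDV hGV hQV hHV hMV X ρ' hρ' hX1 hX2 hslice 𝔹 h𝔹 U₁ hU₁ hcrit Y hY t ht
  -- abbreviations
  set η : ℝ := (((F.P K).L : ℝ)⁻¹) ^ (K - n) with hηdef
  set c : ℝ := ((F.P K).L ^ (K - n) : ℝ) with hcdef
  have hL0 : (0 : ℝ) < (F.P K).L := Nat.cast_pos.2 (F.P K).L_pos
  have hη0 : 0 < η := by rw [hηdef]; positivity
  have hηne : η ≠ 0 := hη0.ne'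
  have hcne : c ≠ 0 := by rw [hcdef]; positivity
  -- the Hermitian letter `A′₁ := (iη)⁻¹•⇑X`: herm0, in the two-size window
  set A₁ : PBond (F.P K) 0 → Matrix (Fin N) (Fin N) ℂ := fun b => (Complex.I * (η : ℂ))⁻¹ • ((X b : lieSU (Fin N)) : Matrix (Fin N) (Fin N) ℂ) with hA₁def
  have hA₁h : ∀ b, A₁ b ∈ herm0 (Fin N) := fun b => inv_I_eta_smul_mem_herm0 (X b).2
  obtain ⟨hA₁1, hA₁2⟩ := hermLetter_rows_lt (P := F.P K) (Λ := (F.L : ℝ) ^ (K - n)) hη0 w X hρ' hX1 hX2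
  -- the tangent letter `X₁ := X` in S1's carrier
  let X₁ : TangentBondSU (F.P K) 0 N := WithLp.toLp 2 X
  have hX₁ : ∀ b, ((X₁ b : lieSU (Fin N)) : Matrix (Fin N) (Fin N) ℂ) = (Complex.I * (η : ℂ)) • A₁ b := by
    intro b
    show ((X b : lieSU (Fin N)) : Matrix (Fin N) (Fin N) ℂ) = (Complex.I * (η : ℂ)) • ((Complex.I * (η : ℂ))⁻¹ • ((X b : lieSU (Fin N)) : Matrix (Fin N) (Fin N) ℂ))
    rw [smul_smul, mul_inv_cancel₀ (mul_ne_zero Complex.I_ne_zero (Complex.ofReal_ne_zero.2 hηne)), one_smul]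
  -- the fourth row `h128` from the socket (p643165), for the current `W_A₁ ⇑X = κ•(W_S A′₁)♮`
  have h128 := h128_of_socket127_flat (N := N) D hηne hcne (fun _ => (1 : ℝ)) hDV hQV X₁ hslice (BE (WS A₁))
    (fun j => (Complex.I * (c : ℂ) ^ 2 * (η : ℂ) ^ (F.P K).d * ((η : ℂ))⁻¹) • (WS A₁ j - (((N : ℂ))⁻¹ * (WS A₁ j).trace) • (1 : Matrix (Fin N) (Fin N) ℂ)))
    (re_trace_pairing_rescaled_current_traceless η c hηne τ hntr BE hBE (WS A₁))
    (fun δ δX hδh hδQ hδX => hsock A₁ δ hA₁1 hA₁2 hA₁h hδh hδQ 𝔹 h𝔹 U₁ hU₁ hcrit X₁ δX hX₁ hδX)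
  -- the A₁ line (p612312) with its four `W`-rows discharged
  exact hA1 n K h1K hKm hMha (le_trans (le_max_left _ _) hMh₀) (le_trans (le_max_left _ _) hR₀) ha' D hDk hAdm w hw hDV hGV hQV hHV hMV
    (fun Y b => (Complex.I * (c : ℂ) ^ 2 * (η : ℂ) ^ (F.P K).d * ((η : ℂ))⁻¹) •
      (WS (fun b' => (Complex.I * (η : ℂ))⁻¹ • Y b') b - (((N : ℂ))⁻¹ * (WS (fun b' => (Complex.I * (η : ℂ))⁻¹ • Y b') b).trace) • (1 : Matrix (Fin N) (Fin N) ℂ)))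
    hWq X (hWAtr X ρ' hρ' hX1 hX2).1 (hWAtr X ρ' hρ' hX1 hX2).2 h128 hρ' hX1 hX2 hslice hY ht

end Summit.QuantumFields.YangMills.Theorems.K0Stub1Letters10OnA1OfFlatSocket

end
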